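import Mathlib
import Literature.MathematicalPhysics.QuantumFieldTheory.Balaban1983to89.B5Bounds167Lattice

/-!
# Bałaban, *Propagators and renormalization transformations for lattice gauge theories. I*
(Commun. Math. Phys. **95** (1984) 17–40) — Sect. D, the action `Δ_k`: the algebra of
(1.58), (1.60), (1.65), (1.66) («Lagrange route»), kernel-checked

[cite: Balaban1984PropagatorsI, Sect. D pp.27–29, (1.55), (1.58), (1.60), (1.64)–(1.67), (1.69)]

## The printed text (pp. 27–29, renders `1984-cmp95-propagators-rt-I-p011/p012/p013-x2.png`)

p. 27: (1.55) «Q_k∂ = ∂₁Q′_k»; «B = B′ + B₀, where B₀ is a constant configuration and B′ is in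
the orthogonal subspace, we can identify Q_kA₀ = B₀, or A₀ = Q_k*B₀»; «φ = Q_kΔ⁻¹Q_k*.  (1.58)»;
«we get ω = + φ⁻¹∂₁λ′ − φ⁻¹B′. The solvability condition gives the equation
∂₁*ω = ∂₁*φ⁻¹∂₁λ′ − ∂₁*φ⁻¹B′ = 0. This equation can be solved with respect to λ′, and we get
λ′ = (∂₁*φ⁻¹∂₁)⁻¹∂₁*φ⁻¹B′.»
p. 28, (1.60): «H_kB = Δ⁻¹Q_k*φ⁻¹B′ + [∂Δ⁻²Q′_k*(Q′_kΔ⁻²Q′_k*)⁻¹ − Δ⁻¹Q_k*φ⁻¹∂₁](∂₁*φ⁻¹∂₁)⁻¹∂₁*φ⁻¹B′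
+ Q_k*B₀», i.e. with `Λ := (∂₁*φ⁻¹∂₁)⁻¹∂₁*φ⁻¹B′`:
`H_kB = Δ⁻¹Q_k*φ⁻¹(B′ − ∂₁Λ) + ∂[Δ⁻²Q′_k*(Q′_kΔ⁻²Q′_k*)⁻¹Λ] + Q_k*B₀`;
(1.61) «(Q_kA)~_μ(p′) = Σ_l u(p′+l) v_μ(p′+l) Ã_μ(p′+l), v_μ(p) = ∂¹_μ(p′)/∂_μ(p)»;
(1.62) «φ_μ(p′) = Σ_l |u(p′+l)|²|v_μ(p′+l)|²/Δ(p′+l)».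
p. 29: «H_kB is a minimum of ½⟨∂A,∂A⟩ on the hyperplane {A : Q_kA = B, R∂*A = 0}»;
(1.65) «⟨B, Δ_kB⟩ = ⟨∂H_kB, ∂H_kB⟩»; (1.66) «⟨B, Δ_kB⟩ = ½ Σ_{μ,ν} ⟨(∂¹_μB_ν − ∂¹_νB_μ),
φ_μ⁻¹φ_ν⁻¹(∂₁*φ⁻¹∂₁)⁻¹(∂¹_μB_ν − ∂¹_νB_μ)⟩ = ⟨∂₁B, σ_k∂₁B⟩ = ½ Σ_{μ,ν} (2π)^{−d} ∫dp′
[ (Σ_{λ=1}^{d} |∂¹_λ(p′)|²/(Δ₀²(p′)φ_λ(p′))) Δ₀(p′)φ_μ(p′)Δ₀(p′)φ_ν(p′) ]⁻¹ |(∂₁B)~_{μν}(p′)|²»;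
(1.69) «⟨A, Δ_aA⟩ = ⟨A, ∂*∂A⟩ + ⟨A, ∂R∂*A⟩ + a⟨A, Q*QA⟩ …, Δ = ∂*∂ + ∂∂*».

## What this module certifies (kernel) and what it does not

* §1 `LagrangeRoute` — ABSTRACT, over real inner-product spaces, hypotheses = the printed operator
  identities by number ((1.69) `⟨A,ΔA⟩ = ‖∂A‖² + ‖∂*A‖²`; `Δ Δ⁻¹ = I`; `Q_k*` is the adjoint of
  `Q_k`; (1.58) `Q_kΔ⁻¹Q_k* φ⁻¹ = I`; the adjoint of (1.55) `∂*Q_k* = Q′_k*∂₁*`; `∂*Δ⁻¹ = Δ⁻¹∂*`;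
  the normal equation `∂₁*φ⁻¹(B′ − ∂₁Λ) = 0` defining `Λ = λ′`; `∂∂ = 0`; `∂(Q_k*B₀) = 0`):
  for `H_kB` of the shape (1.60), `‖∂H_kB‖² = ⟨B′ − ∂₁Λ, φ⁻¹(B′ − ∂₁Λ)⟩` (`normSq_curl_HkB`), and
  this value is the minimum over `λ` of `⟨B′ − ∂₁λ, φ⁻¹(B′ − ∂₁λ)⟩` (`energy_le`).  This is the
  «Lagrange route» of the cell's prose certificate (GAPS C-adv4-32), now kernel-checked AS LOGIC;
  the instantiation of the hypotheses by the concrete operators of (1.30)/(1.55)/(1.69) on `T_η` is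
  NOT done here.
* §2 `Fibre` — CONCRETE fibre algebra at a fixed momentum `p′` (`φ_μ > 0`, `c := Σ_λ |∂¹_λ|²/φ_λ
  > 0`): completing the square `Σ_μ |B_μ − ∂¹_μλ|²/φ_μ = ⟨B, MB⟩ + c |λ − λ*|²` with
  `⟨B, MB⟩ = Σ_μ |B_μ|²/φ_μ − |Σ_μ conj(∂¹_μ)B_μ/φ_μ|²/c` (the symbol of
  `φ⁻¹ − φ⁻¹∂₁(∂₁*φ⁻¹∂₁)⁻¹∂₁*φ⁻¹`) and `λ* = (Σ_μ conj(∂¹_μ)B_μ/φ_μ)/c` (the symbol of `Λ`), and the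
  weighted Lagrange identity `⟨B, MB⟩ = ½ Σ_{μ,ν} |∂¹_μB_ν − ∂¹_νB_μ|²/(φ_μφ_νc)` («by expansion»
  in C-adv4-32) — the first expression of (1.66), fibrewise.
* §3 `Link` — the weight of the landed third expression (`B5Bounds167Lattice.w166`) IS
  `1/(φ_μφ_νc)` on the punctured zone (`Δ₀²` cancels), hence
  `B5Bounds167Lattice.formDk n M B = Σ_{p′ ≠ 0} ⟨B̃(p′), M(p′)B̃(p′)⟩ = Σ_{p′ ≠ 0} min_λ Σ_μ
  |B̃_μ(p′) − ∂¹_μ(p′)λ|²/φ_μ(p′)`: the third expression of (1.66) equals the first, fibre by fibre,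
  and is the minimum over a unit-lattice scalar field of the `φ⁻¹`-energy of `B̃ − ∂₁λ`.

HONEST SCOPE.  NOT certified here: (i) that Bałaban's concrete `T_η` operators satisfy the
hypotheses of §1 (each is a standard lattice identity, prose-certified in GAPS C-adv4-31/C-adv4-32,
numerically cross-checked in C-B5-9); (ii) the position ↔ momentum Plancherel step identifying
`⟨B′ − ∂₁Λ, φ⁻¹(B′ − ∂₁Λ)⟩` on `T₁^{(k)}` with the fibre sum of §3 (the module works on the Fourier
side throughout, `B̃ = B5Bounds167Lattice.hat`, where for `p′ ≠ 0` the constant part `B₀` is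
invisible); (iii) anything about `Z_k` of (1.64).  No statement of the paper is used as a
hypothesis anywhere in this file; §1's hypotheses are explicit binders discharged by nobody here.
-/

noncomputable section

namespace Literature.MathematicalPhysics.QuantumFieldTheory.Balaban1983to89.B5Action165Lagrange

open scoped BigOperators ComplexConjugate InnerProductSpace
open Finset Complex
open Literature.MathematicalPhysics.QuantumFieldTheory.Balaban1983to89.B4Strip
open Literature.MathematicalPhysics.QuantumFieldTheory.Balaban1983to89.B5Prop11Leaves
open Literature.MathematicalPhysics.QuantumFieldTheory.Balaban1983to89.B5Prop11Fiber
open Literature.MathematicalPhysics.QuantumFieldTheory.Balaban1983to89.B5Prop11Plancherel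
open Literature.MathematicalPhysics.QuantumFieldTheory.Balaban1983to89.B5Bounds167Lattice

variable {d : ℕ}

/-! ## §1. The Lagrange route (1.60) ⇒ (1.65) = ⟨B′ − ∂₁Λ, φ⁻¹(B′ − ∂₁Λ)⟩, abstractly -/

section LagrangeRoute

variable {V W S S₁ P : Type*}
  [NormedAddCommGroup V] [InnerProductSpace ℝ V]
  [NormedAddCommGroup W] [InnerProductSpace ℝ W]
  [NormedAddCommGroup S] [InnerProductSpace ℝ S]
  [NormedAddCommGroup S₁] [InnerProductSpace ℝ S₁]
  [NormedAddCommGroup P] [InnerProductSpace ℝ P]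

/-- **(1.60) ⇒ (1.65) = first expression of (1.66), as logic.**  Spaces: `V` fine vector fields
(bonds of `T_η`), `W` unit-lattice vector fields (bonds of `T₁^{(k)}`), `S` fine scalars, `S₁`
unit-lattice scalars, `P` plaquette fields.  Operators: `curl = ∂` on vector fields, `dv = ∂*`,
`grad = ∂` on scalars, `Δ`, `G = Δ⁻¹`, `Q = Q_k`, `Qs = Q_k*`, `φinv = φ⁻¹`, `grad₁ = ∂₁`,
`dv₁ = ∂₁*`, `Q's = Q′_k*`, `Gs = Δ⁻¹` on scalars.  Hypotheses, each a printed identity: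
`h169` (1.69) `Δ = ∂*∂ + ∂∂*` in the form `⟨A,ΔA⟩ = ‖∂A‖² + ‖∂*A‖²`; `hG` `ΔΔ⁻¹ = I`; `hadj` `Q_k*`
is the adjoint of `Q_k`; `h158` (1.58) `φ = Q_kΔ⁻¹Q_k*`, as `Q_kΔ⁻¹Q_k*φ⁻¹ = I`; `h155` the adjoint
of (1.55) `Q_k∂ = ∂₁Q′_k`, i.e. `∂*Q_k* = Q′_k*∂₁*`; `hcomm` `∂*Δ⁻¹ = Δ⁻¹∂*`; `hΛ` the normal
equation `∂₁*φ⁻¹(B′ − ∂₁Λ) = 0`, i.e. «Λ = (∂₁*φ⁻¹∂₁)⁻¹∂₁*φ⁻¹B′» (p. 27 «λ′», solvability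
«∂₁*ω = 0»); `hdd` `∂∂ = 0`; `hB₀` `∂(Q_k*B₀) = 0` (a constant field is curl-free).  Conclusion: for
`H_kB = Δ⁻¹Q_k*φ⁻¹(B′ − ∂₁Λ) + ∂ω + Q_k*B₀` (the shape of (1.60), `ω = Δ⁻²Q′_k*(Q′_kΔ⁻²Q′_k*)⁻¹Λ`),
`‖∂H_kB‖² = ⟨B′ − ∂₁Λ, φ⁻¹(B′ − ∂₁Λ)⟩`.  Three lines: the last two terms are curl-free;
`∂*A* = Δ⁻¹Q′_k*∂₁*φ⁻¹(B′ − ∂₁Λ) = 0`; `⟨A*, ΔA*⟩ = ⟨Q_kΔ⁻¹Q_k*φ⁻¹B″, φ⁻¹B″⟩ = ⟨B″, φ⁻¹B″⟩`.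
[cite: Balaban1984PropagatorsI, (1.60) p.28, (1.65)–(1.66) p.29] -/
theorem normSq_curl_HkB
    (curl : V →ₗ[ℝ] P) (dv : V →ₗ[ℝ] S) (grad : S →ₗ[ℝ] V) (Δ G : V →ₗ[ℝ] V)
    (Q : V →ₗ[ℝ] W) (Qs : W →ₗ[ℝ] V) (φinv : W →ₗ[ℝ] W) (grad₁ : S₁ →ₗ[ℝ] W)
    (dv₁ : W →ₗ[ℝ] S₁) (Q's : S₁ →ₗ[ℝ] S) (Gs : S →ₗ[ℝ] S)
    (h169 : ∀ A, ⟪A, Δ A⟫_ℝ = ‖curl A‖ ^ 2 + ‖dv A‖ ^ 2)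
    (hG : ∀ v, Δ (G v) = v)
    (hadj : ∀ A y, ⟪Q A, y⟫_ℝ = ⟪A, Qs y⟫_ℝ)
    (h158 : ∀ y, Q (G (Qs (φinv y))) = y)
    (h155 : ∀ y, dv (Qs y) = Q's (dv₁ y))
    (hcomm : ∀ v, dv (G v) = Gs (dv v))
    (hdd : ∀ s, curl (grad s) = 0)
    (B' : W) (Λ : S₁) (hΛ : dv₁ (φinv (B' - grad₁ Λ)) = 0)
    (ω : S) (B₀ : W) (hB₀ : curl (Qs B₀) = 0) :
    ‖curl (G (Qs (φinv (B' - grad₁ Λ))) + grad ω + Qs B₀)‖ ^ 2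
      = ⟪B' - grad₁ Λ, φinv (B' - grad₁ Λ)⟫_ℝ := by
  set B'' := B' - grad₁ Λ with hB''
  set A := G (Qs (φinv B'')) with hA
  have h1 : curl (A + grad ω + Qs B₀) = curl A := by
    rw [map_add, map_add, hdd, hB₀, add_zero, add_zero]
  have h2 : dv A = 0 := by
    rw [hA, hcomm, h155, hΛ, map_zero, map_zero]
  have h3 : ‖curl A‖ ^ 2 = ⟪A, Δ A⟫_ℝ := by
    rw [h169, h2, norm_zero]
    ring
  rw [h1, h3, hA, hG, ← hadj, h158]

/-- the printed grouping of (1.60), «Δ⁻¹Q_k*φ⁻¹B′ + [∂Δ⁻²Q′_k*(Q′_kΔ⁻²Q′_k*)⁻¹ − Δ⁻¹Q_k*φ⁻¹∂₁]Λ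
+ Q_k*B₀» (with `ω := Δ⁻²Q′_k*(Q′_kΔ⁻²Q′_k*)⁻¹Λ`, so that the bracket applied to `Λ` is
`∂ω − Δ⁻¹Q_k*φ⁻¹∂₁Λ`), regrouped by linearity as `Δ⁻¹Q_k*φ⁻¹(B′ − ∂₁Λ) + ∂ω + Q_k*B₀`.
[cite: Balaban1984PropagatorsI, (1.60) p.28] -/
theorem regroup160 (grad : S →ₗ[ℝ] V) (G : V →ₗ[ℝ] V) (Qs : W →ₗ[ℝ] V) (φinv : W →ₗ[ℝ] W)
    (grad₁ : S₁ →ₗ[ℝ] W) (B' : W) (Λ : S₁) (ω : S) (B₀ : W) :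
    G (Qs (φinv B')) + (grad ω - G (Qs (φinv (grad₁ Λ)))) + Qs B₀
      = G (Qs (φinv (B' - grad₁ Λ))) + grad ω + Qs B₀ := by
  rw [map_sub, map_sub, map_sub]
  abel

/-- `normSq_curl_HkB` for `H_kB` written in the printed grouping of (1.60).
[cite: Balaban1984PropagatorsI, (1.60) p.28, (1.65)–(1.66) p.29] -/
theorem normSq_curl_HkB_printed
    (curl : V →ₗ[ℝ] P) (dv : V →ₗ[ℝ] S) (grad : S →ₗ[ℝ] V) (Δ G : V →ₗ[ℝ] V)
    (Q : V →ₗ[ℝ] W) (Qs : W →ₗ[ℝ] V) (φinv : W →ₗ[ℝ] W) (grad₁ : S₁ →ₗ[ℝ] W)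
    (dv₁ : W →ₗ[ℝ] S₁) (Q's : S₁ →ₗ[ℝ] S) (Gs : S →ₗ[ℝ] S)
    (h169 : ∀ A, ⟪A, Δ A⟫_ℝ = ‖curl A‖ ^ 2 + ‖dv A‖ ^ 2)
    (hG : ∀ v, Δ (G v) = v)
    (hadj : ∀ A y, ⟪Q A, y⟫_ℝ = ⟪A, Qs y⟫_ℝ)
    (h158 : ∀ y, Q (G (Qs (φinv y))) = y)
    (h155 : ∀ y, dv (Qs y) = Q's (dv₁ y))
    (hcomm : ∀ v, dv (G v) = Gs (dv v))
    (hdd : ∀ s, curl (grad s) = 0)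
    (B' : W) (Λ : S₁) (hΛ : dv₁ (φinv (B' - grad₁ Λ)) = 0)
    (ω : S) (B₀ : W) (hB₀ : curl (Qs B₀) = 0) :
    ‖curl (G (Qs (φinv B')) + (grad ω - G (Qs (φinv (grad₁ Λ)))) + Qs B₀)‖ ^ 2
      = ⟪B' - grad₁ Λ, φinv (B' - grad₁ Λ)⟫_ℝ := by
  rw [regroup160]
  exact normSq_curl_HkB curl dv grad Δ G Q Qs φinv grad₁ dv₁ Q's Gs h169 hG hadj h158 h155 hcomm
    hdd B' Λ hΛ ω B₀ hB₀

/-- **The value of §1 is a minimum** («H_kB is a minimum of ½⟨∂A,∂A⟩ on the hyperplane …»,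
p. 29, in the reduced form of p. 27: `λ′` minimises `⟨B′ − ∂₁λ, φ⁻¹(B′ − ∂₁λ)⟩`): if `φ⁻¹` is
symmetric and positive, `∂₁*` is the adjoint of `∂₁`, and `Λ` solves the normal equation, then
`⟨B′ − ∂₁Λ, φ⁻¹(B′ − ∂₁Λ)⟩ ≤ ⟨B′ − ∂₁λ, φ⁻¹(B′ − ∂₁λ)⟩` for every `λ`; in fact the difference is
`⟨∂₁(λ − Λ), φ⁻¹∂₁(λ − Λ)⟩`. [folklore] -/
theorem energy_eq_add (φinv : W →ₗ[ℝ] W) (grad₁ : S₁ →ₗ[ℝ] W) (dv₁ : W →ₗ[ℝ] S₁)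
    (hsym : ∀ x y, ⟪φinv x, y⟫_ℝ = ⟪x, φinv y⟫_ℝ)
    (hadj₁ : ∀ s y, ⟪grad₁ s, y⟫_ℝ = ⟪s, dv₁ y⟫_ℝ)
    (B' : W) (Λ : S₁) (hΛ : dv₁ (φinv (B' - grad₁ Λ)) = 0) (μ : S₁) :
    ⟪B' - grad₁ μ, φinv (B' - grad₁ μ)⟫_ℝ
      = ⟪B' - grad₁ Λ, φinv (B' - grad₁ Λ)⟫_ℝ + ⟪grad₁ (μ - Λ), φinv (grad₁ (μ - Λ))⟫_ℝ := by
  have hsplit : B' - grad₁ μ = (B' - grad₁ Λ) - grad₁ (μ - Λ) := by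
    rw [map_sub]; abel
  have hcross : ⟪grad₁ (μ - Λ), φinv (B' - grad₁ Λ)⟫_ℝ = 0 := by
    rw [hadj₁, hΛ, inner_zero_right]
  have hcross' : ⟪B' - grad₁ Λ, φinv (grad₁ (μ - Λ))⟫_ℝ = 0 := by
    rw [← hsym, real_inner_comm, hcross]
  rw [hsplit, map_sub φinv, inner_sub_left, inner_sub_right, inner_sub_right, hcross, hcross']
  ring

/-- the minimum property: `⟨B′ − ∂₁Λ, φ⁻¹(B′ − ∂₁Λ)⟩ ≤ ⟨B′ − ∂₁λ, φ⁻¹(B′ − ∂₁λ)⟩` for every `λ`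
(`φ⁻¹` symmetric and positive, `Λ` solving the normal equation). [folklore] -/
theorem energy_le (φinv : W →ₗ[ℝ] W) (grad₁ : S₁ →ₗ[ℝ] W) (dv₁ : W →ₗ[ℝ] S₁)
    (hsym : ∀ x y, ⟪φinv x, y⟫_ℝ = ⟪x, φinv y⟫_ℝ) (hpos : ∀ x, 0 ≤ ⟪x, φinv x⟫_ℝ)
    (hadj₁ : ∀ s y, ⟪grad₁ s, y⟫_ℝ = ⟪s, dv₁ y⟫_ℝ)
    (B' : W) (Λ : S₁) (hΛ : dv₁ (φinv (B' - grad₁ Λ)) = 0) (μ : S₁) :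
    ⟪B' - grad₁ Λ, φinv (B' - grad₁ Λ)⟫_ℝ ≤ ⟪B' - grad₁ μ, φinv (B' - grad₁ μ)⟫_ℝ := by
  rw [energy_eq_add φinv grad₁ dv₁ hsym hadj₁ B' Λ hΛ μ]
  linarith [hpos (grad₁ (μ - Λ))]

end LagrangeRoute

/-! ## §2. The fibre algebra of (1.66) at a fixed momentum `p′` -/

section Fibre

variable {ι : Type*} [Fintype ι]

/-- `c(p′) := Σ_λ |∂¹_λ(p′)|²/φ_λ(p′)`, the symbol of `∂₁*φ⁻¹∂₁` (times `Δ₀²(p′)` it is the printed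
`Σ_λ |∂¹_λ|²/(Δ₀²φ_λ)` of (1.66)). [cite: Balaban1984PropagatorsI, (1.66) p.29] -/
def cSym (φ : ι → ℝ) (e : ι → ℂ) : ℝ := ∑ i, ‖e i‖ ^ 2 / φ i

/-- `P(p′) := Σ_μ conj(∂¹_μ(p′)) B_μ/φ_μ(p′)`, the symbol of `∂₁*φ⁻¹B′`.
[cite: Balaban1984PropagatorsI, p.27 «λ′ = (∂₁*φ⁻¹∂₁)⁻¹∂₁*φ⁻¹B′»] -/
def proj (φ : ι → ℝ) (e B : ι → ℂ) : ℂ := ∑ i, conj (e i) * B i / (φ i : ℂ)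

/-- `λ*(p′) := P(p′)/c(p′)`, the symbol of `Λ = λ′ = (∂₁*φ⁻¹∂₁)⁻¹∂₁*φ⁻¹B′`.
[cite: Balaban1984PropagatorsI, p.27] -/
def lamStar (φ : ι → ℝ) (e B : ι → ℂ) : ℂ := proj φ e B / (cSym φ e : ℂ)

/-- the `φ⁻¹`-energy of `B − ∂₁λ` at `p′`: `Σ_μ |B_μ − ∂¹_μ(p′)λ|²/φ_μ(p′)`. [folklore] -/
def lform (φ : ι → ℝ) (e B : ι → ℂ) (l : ℂ) : ℝ := ∑ i, ‖B i - e i * l‖ ^ 2 / φ i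

/-- `⟨B, M(p′)B⟩ := Σ_μ |B_μ|²/φ_μ − |P|²/c`, the symbol of
`φ⁻¹ − φ⁻¹∂₁(∂₁*φ⁻¹∂₁)⁻¹∂₁*φ⁻¹` (GAPS C-adv4-32's `M`). [cite: Balaban1984PropagatorsI, (1.66) p.29] -/
def mform (φ : ι → ℝ) (e B : ι → ℂ) : ℝ := (∑ i, ‖B i‖ ^ 2 / φ i) - ‖proj φ e B‖ ^ 2 / cSym φ e

/-- `c(p′) ≥ 0`. [folklore] -/
theorem cSym_nonneg (φ : ι → ℝ) (hφ : ∀ i, 0 < φ i) (e : ι → ℂ) : 0 ≤ cSym φ e :=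
  Finset.sum_nonneg fun i _ => div_nonneg (sq_nonneg _) (hφ i).le

/-- `c(p′) > 0` as soon as one `∂¹_λ(p′) ≠ 0` (i.e. `p′ ≠ 0`). [folklore] -/
theorem cSym_pos (φ : ι → ℝ) (hφ : ∀ i, 0 < φ i) (e : ι → ℂ) (i₀ : ι) (hi₀ : e i₀ ≠ 0) :
    0 < cSym φ e := by
  unfold cSym
  refine lt_of_lt_of_le ?_ (Finset.single_le_sum (fun i _ => div_nonneg (sq_nonneg _) (hφ i).le)
    (Finset.mem_univ i₀))
  exact div_pos (pow_pos (norm_pos_iff.mpr hi₀) 2) (hφ i₀)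

/-- the conjugate symbol `Σ_μ ∂¹_μ conj(B_μ)/φ_μ = conj P`. [folklore] -/
theorem conj_proj (φ : ι → ℝ) (e B : ι → ℂ) :
    conj (proj φ e B) = ∑ i, e i * conj (B i) / (φ i : ℂ) := by
  unfold proj
  rw [map_sum]
  refine Finset.sum_congr rfl fun i _ => ?_
  rw [map_div₀, map_mul, Complex.conj_conj, Complex.conj_ofReal]

/-- **Completing the square** (the Lagrange multiplier `λ′` of p. 27, fibrewise): for `φ_μ > 0` and
`c > 0`, `Σ_μ |B_μ − ∂¹_μλ|²/φ_μ = ⟨B, MB⟩ + c |λ − λ*|²`. [folklore] -/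
theorem lform_eq_mform_add (φ : ι → ℝ) (hφ : ∀ i, 0 < φ i) (e B : ι → ℂ) (hc : 0 < cSym φ e)
    (l : ℂ) : lform φ e B l = mform φ e B + cSym φ e * ‖l - lamStar φ e B‖ ^ 2 := by
  apply Complex.ofReal_injective
  have hφ' : ∀ i, (φ i : ℂ) ≠ 0 := fun i => Complex.ofReal_ne_zero.mpr (hφ i).ne'
  have hcC : ((cSym φ e : ℝ) : ℂ) = ∑ i, e i * conj (e i) / (φ i : ℂ) := by
    unfold cSym; push_cast
    exact Finset.sum_congr rfl fun i _ => by rw [← Complex.mul_conj']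
  have hC' : (∑ i, e i * conj (e i) / (φ i : ℂ)) ≠ 0 := hcC ▸ Complex.ofReal_ne_zero.mpr hc.ne'
  have hPQ : conj (proj φ e B) = ∑ i, e i * conj (B i) / (φ i : ℂ) := conj_proj φ e B
  have hL : ((lform φ e B l : ℝ) : ℂ)
      = (∑ i, B i * conj (B i) / (φ i : ℂ)) - conj l * (∑ i, conj (e i) * B i / (φ i : ℂ))
        - l * (∑ i, e i * conj (B i) / (φ i : ℂ))
        + l * conj l * (∑ i, e i * conj (e i) / (φ i : ℂ)) := by
    unfold lform; push_cast
    have hterm : ∀ i, ((‖B i - e i * l‖ : ℝ) : ℂ) ^ 2 / (φ i : ℂ)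
        = B i * conj (B i) / (φ i : ℂ) - conj l * (conj (e i) * B i / (φ i : ℂ))
          - l * (e i * conj (B i) / (φ i : ℂ)) + l * conj l * (e i * conj (e i) / (φ i : ℂ)) := by
      intro i
      rw [← Complex.mul_conj', map_sub, map_mul]
      field_simp
      ring
    rw [Finset.sum_congr rfl fun i _ => hterm i]
    simp only [Finset.sum_add_distrib, Finset.sum_sub_distrib, ← Finset.mul_sum]
  have hR : ((mform φ e B + cSym φ e * ‖l - lamStar φ e B‖ ^ 2 : ℝ) : ℂ)
      = (∑ i, B i * conj (B i) / (φ i : ℂ))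
        - proj φ e B * (∑ i, e i * conj (B i) / (φ i : ℂ)) / (cSym φ e : ℂ)
        + (cSym φ e : ℂ) * ((l - proj φ e B / (cSym φ e : ℂ))
            * (conj l - (∑ i, e i * conj (B i) / (φ i : ℂ)) / (cSym φ e : ℂ))) := by
    unfold mform lamStar; push_cast
    simp only [← Complex.mul_conj', map_sub, map_div₀, Complex.conj_ofReal, hPQ]
  rw [hL, hR, hcC]
  unfold proj
  field_simp
  ring

/-- the minimum over `λ` is attained at `λ*`: `Σ_μ |B_μ − ∂¹_μλ*|²/φ_μ = ⟨B, MB⟩`. [folklore] -/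
theorem lform_lamStar (φ : ι → ℝ) (hφ : ∀ i, 0 < φ i) (e B : ι → ℂ) (hc : 0 < cSym φ e) :
    lform φ e B (lamStar φ e B) = mform φ e B := by
  rw [lform_eq_mform_add φ hφ e B hc, sub_self, norm_zero]
  ring

/-- … and it is a minimum: `⟨B, MB⟩ ≤ Σ_μ |B_μ − ∂¹_μλ|²/φ_μ` for every `λ`. [folklore] -/
theorem mform_le_lform (φ : ι → ℝ) (hφ : ∀ i, 0 < φ i) (e B : ι → ℂ) (hc : 0 < cSym φ e)
    (l : ℂ) : mform φ e B ≤ lform φ e B l := by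
  rw [lform_eq_mform_add φ hφ e B hc l]
  have : 0 ≤ cSym φ e * ‖l - lamStar φ e B‖ ^ 2 := by positivity
  linarith

/-- **The weighted Lagrange identity** («by expansion», GAPS C-adv4-32; the first expression of
(1.66), fibrewise): for `φ_μ > 0` and `c > 0`,
`⟨B, MB⟩ = ½ Σ_{μ,ν} |∂¹_μB_ν − ∂¹_νB_μ|²/(φ_μ φ_ν c)`. [cite: Balaban1984PropagatorsI, (1.66) p.29] -/
theorem mform_eq_half_sum (φ : ι → ℝ) (hφ : ∀ i, 0 < φ i) (e B : ι → ℂ) (hc : 0 < cSym φ e) :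
    mform φ e B = 1 / 2 * ∑ i, ∑ j, ‖e i * B j - e j * B i‖ ^ 2 / (φ i * φ j * cSym φ e) := by
  apply Complex.ofReal_injective
  have hφ' : ∀ i, (φ i : ℂ) ≠ 0 := fun i => Complex.ofReal_ne_zero.mpr (hφ i).ne'
  have hc' : ((cSym φ e : ℝ) : ℂ) ≠ 0 := Complex.ofReal_ne_zero.mpr hc.ne'
  have hcC : ((cSym φ e : ℝ) : ℂ) = ∑ i, e i * conj (e i) / (φ i : ℂ) := by
    unfold cSym; push_cast
    exact Finset.sum_congr rfl fun i _ => by rw [← Complex.mul_conj']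
  have hC' : (∑ i, e i * conj (e i) / (φ i : ℂ)) ≠ 0 := hcC ▸ hc'
  have hPQ : conj (proj φ e B) = ∑ i, e i * conj (B i) / (φ i : ℂ) := conj_proj φ e B
  have hL : ((mform φ e B : ℝ) : ℂ)
      = (∑ i, B i * conj (B i) / (φ i : ℂ))
        - proj φ e B * (∑ i, e i * conj (B i) / (φ i : ℂ)) / (cSym φ e : ℂ) := by
    unfold mform; push_cast
    simp only [← Complex.mul_conj', hPQ]
  have hterm : ∀ i j,
      ((‖e i * B j - e j * B i‖ : ℝ) : ℂ) ^ 2 / ((φ i : ℂ) * (φ j : ℂ) * (cSym φ e : ℂ))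
        = ((e i * conj (e i) / (φ i : ℂ)) * (B j * conj (B j) / (φ j : ℂ))
            + (B i * conj (B i) / (φ i : ℂ)) * (e j * conj (e j) / (φ j : ℂ))
            - (e i * conj (B i) / (φ i : ℂ)) * (conj (e j) * B j / (φ j : ℂ))
            - (conj (e i) * B i / (φ i : ℂ)) * (e j * conj (B j) / (φ j : ℂ))) / (cSym φ e : ℂ) := by
    intro i j
    rw [← Complex.mul_conj', map_sub, map_mul, map_mul]
    field_simp
    ring
  have hD : ((1 / 2 * ∑ i, ∑ j, ‖e i * B j - e j * B i‖ ^ 2 / (φ i * φ j * cSym φ e) : ℝ) : ℂ)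
      = 1 / 2 * (((∑ i, e i * conj (e i) / (φ i : ℂ)) * (∑ j, B j * conj (B j) / (φ j : ℂ))
          + (∑ i, B i * conj (B i) / (φ i : ℂ)) * (∑ j, e j * conj (e j) / (φ j : ℂ))
          - (∑ i, e i * conj (B i) / (φ i : ℂ)) * (∑ j, conj (e j) * B j / (φ j : ℂ))
          - (∑ i, conj (e i) * B i / (φ i : ℂ)) * (∑ j, e j * conj (B j) / (φ j : ℂ)))
          / (cSym φ e : ℂ)) := by
    push_cast
    rw [Finset.sum_congr rfl fun i _ => Finset.sum_congr rfl fun j _ => hterm i j]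
    simp only [← Finset.sum_div, Finset.sum_add_distrib, Finset.sum_sub_distrib, ← Finset.mul_sum,
      ← Finset.sum_mul]
  rw [hL, hD, hcC]
  unfold proj
  field_simp
  ring

/-- `⟨B, MB⟩ ≥ 0`. [folklore] -/
theorem mform_nonneg (φ : ι → ℝ) (hφ : ∀ i, 0 < φ i) (e B : ι → ℂ) (hc : 0 < cSym φ e) :
    0 ≤ mform φ e B := by
  rw [mform_eq_half_sum φ hφ e B hc]
  have : ∀ i j, 0 ≤ ‖e i * B j - e j * B i‖ ^ 2 / (φ i * φ j * cSym φ e) := fun i j =>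
    div_nonneg (sq_nonneg _) (mul_nonneg (mul_nonneg (hφ i).le (hφ j).le) hc.le)
  exact mul_nonneg (by norm_num) (Finset.sum_nonneg fun i _ => Finset.sum_nonneg fun j _ => this i j)

end Fibre

/-! ## §3. Link with the landed third expression of (1.66) (`B5Bounds167Lattice.formDk`) -/

section Link

variable (n : ℕ) (M : Fin d → ℕ) [hM : ∀ μ, NeZero (M μ)]

/-- the fibre data of (1.62)/(1.66) at the reduced momentum `s = p′`: `φ(p′) = (φ_μ(p′))_μ`
(`B5Bounds167Lattice.phi162`). [cite: Balaban1984PropagatorsI, (1.62) p.28] -/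
def phiVec (s : Fin d → ℝ) : Fin d → ℝ := fun μ => phi162 n μ s

/-- `φ_μ(p′) > 0` on the punctured Brillouin zone (from `0 < (4/π²)^{d+2} ≤ Δ₀φ_μ`, `Δ₀ > 0`).
[cite: Balaban1984PropagatorsI, p.28 after (1.62)] -/
theorem phi162_pos [NeZero n] (hn : 1 ≤ n) (μ : Fin d) (s : Fin d → ℝ)
    (hs : ∀ ν, |s ν| ≤ Real.pi) (ν₀ : Fin d) (hν₀ : s ν₀ ≠ 0) : 0 < phi162 n μ s := by
  have h1 := Delta0_phi162_lower n hn μ s hs ν₀ hν₀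
  have h2 : 0 < Delta1r 0 s := Delta1r_pos s hs ν₀ hν₀
  have h3 : 0 < (4 / Real.pi ^ 2 : ℝ) ^ (d + 2) := by positivity
  by_contra h
  have : Delta1r 0 s * phi162 n μ s ≤ 0 := mul_nonpos_of_nonneg_of_nonpos h2.le (not_lt.mp h)
  linarith

/-- `c(p′) > 0` on the punctured Brillouin zone. [folklore] -/
theorem cSym_phiVec_pos [NeZero n] (hn : 1 ≤ n) (s : Fin d → ℝ) (hs : ∀ ν, |s ν| ≤ Real.pi)
    (ν₀ : Fin d) (hν₀ : s ν₀ ≠ 0) : 0 < cSym (phiVec n s) (d1Sym s) := by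
  refine cSym_pos _ (fun μ => phi162_pos n hn μ s hs ν₀ hν₀) _ ν₀ ?_
  intro h
  have hle : ‖d1Sym s ν₀‖ ^ 2 ≤ 0 := by rw [h, norm_zero]; norm_num
  have hS : ‖d1Sym s ν₀‖ ^ 2 = S1r (s ν₀) := norm_d1Sym_sq s ν₀
  have hpos : 0 < S1r (s ν₀) := by
    have h4 := S1r_ge (s ν₀) (hs ν₀)
    have h0 : 0 < (s ν₀) ^ 2 := lt_of_le_of_ne (sq_nonneg _) (Ne.symm (pow_ne_zero 2 hν₀))
    have h5 : 0 < 4 * (s ν₀) ^ 2 / Real.pi ^ 2 := by positivity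
    linarith
  linarith

/-- **the weight of the third expression IS `1/(φ_μ φ_ν c)`** (`Δ₀²` cancels):
`w166 = [ (Σ_λ |∂¹_λ|²/(Δ₀²φ_λ)) Δ₀φ_μ Δ₀φ_ν ]⁻¹ = (φ_μ φ_ν c)⁻¹` for `p′ ≠ 0`.
[cite: Balaban1984PropagatorsI, (1.66) p.29] -/
theorem w166_eq (μ ν : Fin d) (s : Fin d → ℝ) (hs : ∀ κ, |s κ| ≤ Real.pi) (ν₀ : Fin d)
    (hν₀ : s ν₀ ≠ 0) :
    w166 n μ ν s = 1 / (phiVec n s μ * phiVec n s ν * cSym (phiVec n s) (d1Sym s)) := by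
  have hΔ : Delta1r 0 s ≠ 0 := (Delta1r_pos s hs ν₀ hν₀).ne'
  unfold w166 cSym phiVec
  have hsum : (∑ κ : Fin d, ‖d1Sym s κ‖ ^ 2 / (Delta1r 0 s ^ 2 * phi162 n κ s))
      = (∑ κ : Fin d, ‖d1Sym s κ‖ ^ 2 / phi162 n κ s) / Delta1r 0 s ^ 2 := by
    rw [Finset.sum_div]
    refine Finset.sum_congr rfl fun κ _ => ?_
    rw [div_div, mul_comm]
  rw [hsum]
  congr 1
  field_simp

/-- **(1.66), first expression = third expression, fibrewise**: for `p ≠ 0`,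
`½ Σ_{μ,ν} w166(p′) |(∂₁B)~_{μν}(p′)|² = ⟨B̃(p′), M(p′)B̃(p′)⟩`.
[cite: Balaban1984PropagatorsI, (1.66) p.29] -/
theorem fibre166 [NeZero n] (hn : 1 ≤ n) (B : Tor M × Fin d → ℂ) (p : Tor M) (hp : p ≠ 0) :
    1 / 2 * ∑ μ, ∑ ν, w166 n μ ν (sOf M p) * ‖curlHat M B μ ν p‖ ^ 2
      = mform (phiVec n (sOf M p)) (d1Sym (sOf M p)) (fun μ => hat M B μ p) := by
  obtain ⟨ν₀, hν₀⟩ := Function.ne_iff.mp (sOf_ne_zero M hp)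
  have hs := abs_sOf_le M p
  have hφ : ∀ μ, 0 < phiVec n (sOf M p) μ := fun μ => phi162_pos n hn μ _ hs ν₀ hν₀
  have hc := cSym_phiVec_pos n hn (sOf M p) hs ν₀ hν₀
  rw [mform_eq_half_sum _ hφ _ _ hc]
  congr 1
  refine Finset.sum_congr rfl fun μ _ => Finset.sum_congr rfl fun ν _ => ?_
  rw [w166_eq n μ ν (sOf M p) hs ν₀ hν₀]
  unfold curlHat
  rw [one_div, inv_mul_eq_div]

/-- **⟨B, Δ_kB⟩ (third expression of (1.66)) = Σ_{p′ ≠ 0} ⟨B̃(p′), M(p′)B̃(p′)⟩** — the first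
expression of (1.66) summed over the punctured torus (at `p′ = 0` the summand of `formDk`
vanishes: `(∂₁B)~(0) = 0`). [cite: Balaban1984PropagatorsI, (1.66) p.29] -/
theorem formDk_eq_sum_mform [NeZero n] (hn : 1 ≤ n) (B : Tor M × Fin d → ℂ) :
    formDk n M B
      = ∑ p ∈ Finset.univ.erase 0,
          mform (phiVec n (sOf M p)) (d1Sym (sOf M p)) (fun μ => hat M B μ p) := by
  set g : Tor M → ℝ :=
    fun p => 1 / 2 * ∑ μ, ∑ ν, w166 n μ ν (sOf M p) * ‖curlHat M B μ ν p‖ ^ 2 with hg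
  have hre : formDk n M B = ∑ p, g p := by
    unfold formDk
    rw [show (∑ μ, ∑ ν, ∑ p, w166 n μ ν (sOf M p) * ‖curlHat M B μ ν p‖ ^ 2)
        = ∑ p, ∑ μ, ∑ ν, w166 n μ ν (sOf M p) * ‖curlHat M B μ ν p‖ ^ 2 from
      (Finset.sum_congr rfl fun μ _ => Finset.sum_comm).trans Finset.sum_comm, Finset.mul_sum]
  have hz : ∀ μ ν, curlHat M B μ ν 0 = 0 := fun μ ν => curlHat_eq_zero_of M B μ ν 0 (sOf_zero M)
  have h0 : g 0 = 0 := by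
    simp [hg, hz]
  rw [hre, ← Finset.add_sum_erase _ g (Finset.mem_univ 0), h0, zero_add]
  exact Finset.sum_congr rfl fun p hp => fibre166 n M hn B p (Finset.ne_of_mem_erase hp)

/-- **… = Σ_{p′ ≠ 0} Σ_μ |B̃_μ(p′) − ∂¹_μ(p′)λ*(p′)|²/φ_μ(p′)**, the `φ⁻¹`-energy of `B̃ − ∂₁Λ` with
`Λ̃ = λ*` the symbol of «λ′ = (∂₁*φ⁻¹∂₁)⁻¹∂₁*φ⁻¹B′» (p. 27) — the Fourier side of §1's
`⟨B′ − ∂₁Λ, φ⁻¹(B′ − ∂₁Λ)⟩`. [cite: Balaban1984PropagatorsI, p.27, (1.66) p.29] -/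
theorem formDk_eq_sum_lform_lamStar [NeZero n] (hn : 1 ≤ n) (B : Tor M × Fin d → ℂ) :
    formDk n M B
      = ∑ p ∈ Finset.univ.erase 0,
          lform (phiVec n (sOf M p)) (d1Sym (sOf M p)) (fun μ => hat M B μ p)
            (lamStar (phiVec n (sOf M p)) (d1Sym (sOf M p)) (fun μ => hat M B μ p)) := by
  rw [formDk_eq_sum_mform n M hn B]
  refine Finset.sum_congr rfl fun p hp => ?_
  obtain ⟨ν₀, hν₀⟩ := Function.ne_iff.mp (sOf_ne_zero M (Finset.ne_of_mem_erase hp))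
  have hs := abs_sOf_le M p
  exact (lform_lamStar _ (fun μ => phi162_pos n hn μ _ hs ν₀ hν₀) _ _
    (cSym_phiVec_pos n hn (sOf M p) hs ν₀ hν₀)).symm

/-- **… and it is the minimum over unit-lattice scalar fields**: for every `λ̃ : T₁ → ℂ`,
`⟨B, Δ_kB⟩ ≤ Σ_{p′ ≠ 0} Σ_μ |B̃_μ(p′) − ∂¹_μ(p′)λ̃(p′)|²/φ_μ(p′)` («H_kB is a minimum …», p. 29,
on the Fourier side). [cite: Balaban1984PropagatorsI, p.29 ll.3–6] -/
theorem formDk_le_sum_lform [NeZero n] (hn : 1 ≤ n) (B : Tor M × Fin d → ℂ) (lam : Tor M → ℂ) :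
    formDk n M B
      ≤ ∑ p ∈ Finset.univ.erase 0,
          lform (phiVec n (sOf M p)) (d1Sym (sOf M p)) (fun μ => hat M B μ p) (lam p) := by
  rw [formDk_eq_sum_mform n M hn B]
  refine Finset.sum_le_sum fun p hp => ?_
  obtain ⟨ν₀, hν₀⟩ := Function.ne_iff.mp (sOf_ne_zero M (Finset.ne_of_mem_erase hp))
  have hs := abs_sOf_le M p
  exact mform_le_lform _ (fun μ => phi162_pos n hn μ _ hs ν₀ hν₀) _ _
    (cSym_phiVec_pos n hn (sOf M p) hs ν₀ hν₀) (lam p)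

end Link

end Literature.MathematicalPhysics.QuantumFieldTheory.Balaban1983to89.B5Action165Lagrange

end
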